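import Summits.QuantumFields.QCD.Theses.WilsonMobilityGap
import Literature.MathematicalPhysics.QuantumFieldTheory.QCDPhaseQuenchedPositivity

/-!
# Crux `MobilityGap` (stmt-QuantumFields-9150) — proof-side definitions of line `Sketch`
(threshold-defined `m_crit`; route WilsonMobilityGap, rank 2)

Route-posited objects and packaged stub / law predicates of the registered skeleton
`Cruxes/MobilityGap/Lines/Sketch.lean` (lead seats prover-line-stmt-QuantumFields-9150-0 / -c1-0), copied
VERBATIM (definition bodies byte-identical; docstrings shortened) so that the registered stubs
(`stub_lightMoment`, `stub_lower`, `stub_extinct` — reshape 2026-08-16 c1 of the wave-1 set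
`stub_lightChannel`/`stub_noJump`/`stub_transport`/`stub_extinct`), the sorry-free glue
(anchor, light-point glue, lower-pin reduction, sign glue, composition — `…SketchReduction.lean`) and the
final skeleton can land under `Theorems/` by name and signature (`Cruxes/…` is not importable from
`Theorems/`).  Nothing of the route is restated: `Clauses` is the crux body after `∃ reg` (so
`MobilityGap` is definitionally `∀ Nf ∈ {2,3}, ∃ reg, Clauses Nf reg`; cf. `MobilityGapNegative.mobilityGap_iff`).

THE LINE. Every datum of the witness is explicit — `a_k := e^{-(k+1)}`, `β_k := afBeta N_f 1 a_k`,
`Z_m(k) := (log a_k⁻²)^{γ₀/2β₀}`, volume floor `L⁰_k := ⌈log(k+2)/a_k⌉` — except the flavour-blind critical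
mass, DEFINED as the order-theoretic threshold of clause (ii) itself:
`m_crit(k) := thrMass := sInf {u ≥ -1 | every bare tuple ≥ u of spread ≤ w_k := k a_k/Z_m(k) is Certified}`,
`Certified` = the (ii)-shape bound with exponent `½`, amplitude `e^{δ}`, physical rate `δ` on all tori
`S ≥ L⁰_k`.  Both scalings, clause (i) and the whole of clause (ii) are then theorems (order logic, no
monotonicity of the physics); the crux's content is isolated in the laws of §6 at that implicit point.
§0 crux re-read · §1 data · §2 threshold · §3 elementary facts · §4 the witness · §5 the entry sum and the
light inputs · §6 packaged laws (the three stub statements and the three composition inputs).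
-/

noncomputable section

namespace Summit.QuantumFields.QCD.Theorems.MobilityGapSketch

open scoped BigOperators Topology
open MeasureTheory Filter Set
open Literature.MathematicalPhysics.QuantumFieldTheory Literature.MathematicalPhysics.QuantumLattice
  Literature.Probability.LatticeModels

/-! ### §0 The crux, re-read (verbatim body) -/

/-- The clauses of the crux for a given regularisation `reg` — VERBATIM the text of
`WilsonMobilityGap.MobilityGap` after `∃ reg : QCDRegularisation Nf,`. -/
def Clauses (Nf : ℕ) (reg : QCDRegularisation Nf) : Prop :=
  reg.HasMassScaling ∧ (reg.scheme 0 0 0).HasAsymptoticScaling ∧ ∀ m : Fin Nf → ℝ, (∀ f, 0 < m f) → (∀ f : Fin Nf, ∀ᶠ k in atTop, -1 < reg.mcrit k + reg.a k * m f / reg.Zm k) ∧ (∃ s δ C : ℝ, 0 < s ∧ s < 1 ∧ 0 < δ ∧ ∀ᶠ k in atTop, ∀ S : ℕ, reg.L k ≤ S → ∀ (f : Fin Nf) (v : Literature.Probability.LatticeModels.Site 4), v ∈ box 4 S → (∫ U : GaugeConfig 4 (2 * S + 1) (Matrix.specialUnitaryGroup (Fin 3) ℂ), ‖(diracMatrix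 U fun fl => reg.mcrit k + reg.a k * m fl / reg.Zm k).det‖ * (∑ a : Fin 3, ∑ i : Fin 4, ∑ b : Fin 3, ∑ j : Fin 4, ‖(diracMatrix U fun fl => reg.mcrit k + reg.a k * m fl / reg.Zm k)⁻¹ (quarkEquiv (f, (Torus.proj (2 * S + 1) 0, a, i))) (quarkEquiv (f, (Torus.proj (2 * S + 1) (v), b, j)))‖) ^ s ∂(wilsonMeasure (fundamentalRep (Fin 3)) (reg.β k))) / (∫ U : GaugeConfig 4 (2 * S + 1) (Matrix.specialUnitaryGroup (Fin 3) ℂ), ‖(diracMatrix U fun fl => reg.mcrit k + reg.a k * m fl / reg.Zm k).det‖ ∂(wilsonMeasure (fundamentalRep (Fin 3)) (reg.β k))) ≤ C * Real.exp (-(δ * (reg.a k * ‖v‖)))) ∧ (∃ s c₀ C₁ p : ℝ, 0 < s ∧ s < 1 ∧ 0 < c₀ ∧ ∀ᶠ k in atTop, ∀ S : ℕ, reg.L k ≤ S → ∀ (f : Fin Nf) (n : ℕ), n ≤ S → c₀ * Real.exp (-(C₁ * (reg.a k * n) + p * Real.log (n + 1))) ≤ (∫ U : GaugeConfig 4 (2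 * S + 1) (Matrix.specialUnitaryGroup (Fin 3) ℂ), ‖(diracMatrix U fun fl => reg.mcrit k + reg.a k * m fl / reg.Zm k).det‖ * (∑ a : Fin 3, ∑ i : Fin 4, ∑ b : Fin 3, ∑ j : Fin 4, ‖(diracMatrix U fun fl => reg.mcrit k + reg.a k * m fl / reg.Zm k)⁻¹ (quarkEquiv (f, (Torus.proj (2 * S + 1) 0, a, i))) (quarkEquiv (f, (Torus.proj (2 * S + 1) (Pi.single 0 (n : ℤ)), b, j)))‖) ^ s ∂(wilsonMeasure (fundamentalRep (Fin 3)) (reg.β k))) / (∫ U : GaugeConfig 4 (2 * S + 1) (Matrix.specialUnitaryGroup (Fin 3) ℂ), ‖(diracMatrix U fun fl => reg.mcrit k + reg.a k * m fl / reg.Zm k).det‖ ∂(wilsonMeasure (fundamentalRep (Fin 3)) (reg.β k)))) ∧ (∀ᶠ k in atTop, (1 / 2 : ℝ) ≤ ‖∫ U : GaugeConfig 4 (2 * reg.L k + 1) (Matrix.specialUnitaryGroup (Fin 3) ℂ), (diracMatrix U fun fl => reg.mcrit k + reg.a k * m fl / reg.Zm k).det ∂(wilsonMeasure (fundamentalRep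 (Fin 3)) (reg.β k))‖ / (∫ U : GaugeConfig 4 (2 * reg.L k + 1) (Matrix.specialUnitaryGroup (Fin 3) ℂ), ‖(diracMatrix U fun fl => reg.mcrit k + reg.a k * m fl / reg.Zm k).det‖ ∂(wilsonMeasure (fundamentalRep (Fin 3)) (reg.β k))))


/-! ### §1 The explicit data of the threshold witness
(adapted from `Cruxes/OneScaleTrajectory/Lines/threshold_tuned_witness.lean`) -/

/-- Lattice spacings `a_k := e^{-(k+1)}` (so `|log a_k| = k+1`, `log a_k⁻² = 2(k+1)`). -/
def aSeq (k : ℕ) : ℝ := Real.exp (-((k : ℝ) + 1))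

/-- Inverse bare couplings on the two-loop profile with `Λ_lat = 1`: asymptotic scaling by fiat. -/
def betaSeq (Nf k : ℕ) : ℝ := afBeta Nf 1 (aSeq k)

/-- The canonical mass renormalisation `Z_m(k) := (log a_k⁻²)^{γ₀/(2β₀)}`: mass scaling by fiat. -/
def zmSeq (Nf k : ℕ) : ℝ := Real.log (1 / aSeq k ^ 2) ^ massExponent Nf

/-- Slab width `w_k := k · a_k / Z_m(k)`: the admissible bare-mass spread of the tuples the threshold
certifies; it dominates `a_k · max|m_f - m_g| / Z_m(k)` eventually for every fixed `m`. -/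
def slabWidth (Nf k : ℕ) : ℝ := (k : ℝ) * aSeq k / zmSeq Nf k

/-- The VOLUME FLOOR `L⁰_k := ⌈log(k+2)/a_k⌉` of the threshold: certificates are demanded on all tori
`S ≥ L⁰_k` (physical side `≥ 2 log(k+2) → ∞`, as slowly as is convenient), INDEPENDENTLY of the volume
sequence `L ≥ L⁰` of the witness, which `stub_extinct` chooses later — so the threshold trajectory does
not depend on that choice (no circularity; a fixed-physical-volume extinction law can be diagonalised
into `stub_extinct`). -/
def volFloor (k : ℕ) : ℕ := ⌈Real.log ((k : ℝ) + 2) / aSeq k⌉₊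

/-- The phase-quenched fractional moment of the flavour-`f` quark propagator from `0` to `v` on the
torus of side `2S+1` at inverse coupling `β` and bare masses `mq` — VERBATIM the functional of clauses
(ii) and (iii) of the crux, with `(β, mq, s)` free. -/
def fm (Nf : ℕ) (β : ℝ) (mq : Fin Nf → ℝ) (S : ℕ) (f : Fin Nf)
    (v : Literature.Probability.LatticeModels.Site 4) (s : ℝ) : ℝ :=
  (∫ U : GaugeConfig 4 (2 * S + 1) (Matrix.specialUnitaryGroup (Fin 3) ℂ),
      ‖(diracMatrix U mq).det‖ *
        (∑ a : Fin 3, ∑ i : Fin 4, ∑ b : Fin 3, ∑ j : Fin 4,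
          ‖(diracMatrix U mq)⁻¹ (quarkEquiv (f, (Torus.proj (2 * S + 1) 0, a, i)))
            (quarkEquiv (f, (Torus.proj (2 * S + 1) v, b, j)))‖) ^ s
      ∂(wilsonMeasure (fundamentalRep (Fin 3)) β)) /
    (∫ U : GaugeConfig 4 (2 * S + 1) (Matrix.specialUnitaryGroup (Fin 3) ℂ),
      ‖(diracMatrix U mq).det‖ ∂(wilsonMeasure (fundamentalRep (Fin 3)) β))

/-! ### §2 The threshold of clause (ii) -/

/-- `Certified δ k t`: the bare tuple `t` obeys the (ii)-SHAPE BOUND with exponent `½`, amplitude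
`e^{δ}` and physical rate `δ` at coupling `β_k`, on EVERY torus `S ≥ L_k`, for every flavour and every
site of the box (on every torus above the volume floor `L⁰_k`):
`E_{|w|,β_k,S}[(Σ|G_f(0,v)|)^{1/2}] ≤ e^{δ} · e^{-δ a_k ‖v‖_∞}`. -/
def Certified (Nf : ℕ) (δ : ℝ) (k : ℕ) (t : Fin Nf → ℝ) : Prop :=
  ∀ S : ℕ, volFloor k ≤ S → ∀ (f : Fin Nf) (v : Literature.Probability.LatticeModels.Site 4), v ∈ box 4 S →
    fm Nf (betaSeq Nf k) t S f v (1 / 2) ≤ Real.exp δ * Real.exp (-(δ * (aSeq k * ‖v‖)))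

/-- `IsGoodFloor δ k u`: every bare tuple with all components `≥ u` and spread `≤ w_k` is certified.
An UP-SET in `u` by its quantifier (`isGoodFloor_mono`). -/
def IsGoodFloor (Nf : ℕ) (δ : ℝ) (k : ℕ) (u : ℝ) : Prop :=
  ∀ t : Fin Nf → ℝ, (∀ f, u ≤ t f) → (∀ f g, |t f - t g| ≤ slabWidth Nf k) → Certified Nf δ k t

/-- The set of good floors on the physical branch `u ≥ -1`. -/
def floorSet (Nf : ℕ) (δ : ℝ) (k : ℕ) : Set ℝ := {u | -1 ≤ u ∧ IsGoodFloor Nf δ k u}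

/-- THE THRESHOLD `m_crit(k) := inf {u ≥ -1 | IsGoodFloor δ k u}` — the flavour-blind critical bare
mass of the witness, defined by the DECAY CLAUSE ITSELF, never by symmetry. Junk value `0` while the
floor set is empty (finitely many `k`, `anchor`). -/
def thrMass (Nf : ℕ) (δ : ℝ) (k : ℕ) : ℝ := sInf (floorSet Nf δ k)

/-! ### §3 Elementary facts about the data (sorry-free) -/

/-- `a_k > 0`. -/
theorem aSeq_pos (k : ℕ) : 0 < aSeq k := Real.exp_pos _

/-- `log a_k = -(k+1)`. -/
theorem log_aSeq (k : ℕ) : Real.log (aSeq k) = -((k : ℝ) + 1) := Real.log_exp _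

/-- `a_k → 0`. -/
theorem tendsto_aSeq : Tendsto aSeq atTop (𝓝 0) := by
  have h : Tendsto (fun k : ℕ => (k : ℝ) + 1) atTop atTop :=
    tendsto_atTop_add_const_right _ 1 tendsto_natCast_atTop_atTop
  exact Real.tendsto_exp_neg_atTop_nhds_zero.comp h

/-- `log a_k⁻² = 2(k+1)`. -/
theorem log_inv_sq_aSeq (k : ℕ) : Real.log (1 / aSeq k ^ 2) = 2 * ((k : ℝ) + 1) := by
  rw [one_div, Real.log_inv, Real.log_pow, log_aSeq]
  push_cast
  ring

/-- `log a_k⁻² > 0`. -/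
theorem log_inv_sq_aSeq_pos (k : ℕ) : 0 < Real.log (1 / aSeq k ^ 2) := by
  rw [log_inv_sq_aSeq]; positivity

/-- `Z_m(k) > 0`. -/
theorem zmSeq_pos (Nf k : ℕ) : 0 < zmSeq Nf k :=
  Real.rpow_pos_of_pos (log_inv_sq_aSeq_pos k) _

/-- `w_k ≥ 0`. -/
theorem slabWidth_nonneg (Nf k : ℕ) : 0 ≤ slabWidth Nf k :=
  div_nonneg (mul_nonneg (Nat.cast_nonneg _) (aSeq_pos k).le) (zmSeq_pos Nf k).le

/-- `log(k+2) ≤ a_k L⁰_k`: the volume floor is admissible (`a_k L⁰_k → ∞`). -/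
theorem log_le_aSeq_mul_volFloor (k : ℕ) : Real.log ((k : ℝ) + 2) ≤ aSeq k * (volFloor k : ℝ) := by
  have ha := aSeq_pos k
  have h := Nat.le_ceil (Real.log ((k : ℝ) + 2) / aSeq k)
  unfold volFloor
  calc Real.log ((k : ℝ) + 2) = aSeq k * (Real.log ((k : ℝ) + 2) / aSeq k) := by field_simp
    _ ≤ aSeq k * (⌈Real.log ((k : ℝ) + 2) / aSeq k⌉₊ : ℝ) := mul_le_mul_of_nonneg_left h ha.le

/-- The volume floor is admissible: `a_k L⁰_k → ∞`. -/
theorem tendsto_aSeq_mul_volFloor : Tendsto (fun k => aSeq k * (volFloor k : ℝ)) atTop atTop := by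
  refine tendsto_atTop_mono log_le_aSeq_mul_volFloor ?_
  have h : Tendsto (fun k : ℕ => (k : ℝ) + 2) atTop atTop :=
    tendsto_atTop_add_const_right _ 2 tendsto_natCast_atTop_atTop
  exact Real.tendsto_log_atTop.comp h

/-- Good floors form an up-set. -/
theorem isGoodFloor_mono {Nf : ℕ} {δ : ℝ} {k : ℕ} {u u' : ℝ} (h : u ≤ u')
    (hu : IsGoodFloor Nf δ k u) : IsGoodFloor Nf δ k u' :=
  fun t ht hsp => hu t (fun f => h.trans (ht f)) hsp

/-- The floor set is bounded below by `-1`. -/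
theorem floorSet_bddBelow (Nf : ℕ) (δ : ℝ) (k : ℕ) : BddBelow (floorSet Nf δ k) :=
  ⟨-1, fun _ hu => hu.1⟩

/-- Clause (i) at the threshold: `-1 ≤ m_crit(k)` as soon as some floor is good. -/
theorem neg_one_le_thrMass {Nf : ℕ} {δ : ℝ} {k : ℕ} (hne : (floorSet Nf δ k).Nonempty) :
    -1 ≤ thrMass Nf δ k :=
  le_csInf hne fun _ hu => hu.1

/-- A good floor bounds the threshold from above. -/
theorem thrMass_le_of_mem {Nf : ℕ} {δ : ℝ} {k : ℕ} {u : ℝ} (hu : u ∈ floorSet Nf δ k) :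
    thrMass Nf δ k ≤ u :=
  csInf_le (floorSet_bddBelow Nf δ k) hu

/-- A bad floor bounds the threshold from below (up-set). -/
theorem le_thrMass_of_not_isGoodFloor {Nf : ℕ} {δ : ℝ} {k : ℕ}
    (hne : (floorSet Nf δ k).Nonempty) {x : ℝ} (hx : ¬ IsGoodFloor Nf δ k x) :
    x ≤ thrMass Nf δ k := by
  refine le_csInf hne fun u hu => ?_
  by_contra h
  exact hx (isGoodFloor_mono (not_le.mp h).le hu.2)

/-- THE LEVER (order logic): a near-degenerate tuple all of whose components lie strictly above the
threshold is certified — it lies above a good floor. No monotonicity or continuity of the physics. -/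
theorem certified_of_thrMass_lt {Nf : ℕ} {δ : ℝ} {k : ℕ}
    (hne : (floorSet Nf δ k).Nonempty) {t : Fin Nf → ℝ} (ht : ∀ f, thrMass Nf δ k < t f)
    (hsp : ∀ f g, |t f - t g| ≤ slabWidth Nf k) : Certified Nf δ k t := by
  classical
  rcases isEmpty_or_nonempty (Fin Nf) with hE | hN
  · intro S _ f
    exact (IsEmpty.false f).elim
  · obtain ⟨f₀, hf₀⟩ := Finite.exists_min t
    obtain ⟨u, hu, hut⟩ := exists_lt_of_csInf_lt hne (ht f₀)
    exact hu.2 t (fun f => hut.le.trans (hf₀ f)) hsp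

/-! ### §4 The threshold witness -/

/-- THE THRESHOLD WITNESS `reg_thr(L, δ)`: `(a_k, β_k, L_k, m_crit := thrMass δ, Z_m)` as in §1–§2; the volume
sequence `L` is a parameter (any admissible `L`, eventually above the floor `L⁰`, serves clause (ii)). -/
def thrReg (Nf : ℕ) (L : ℕ → ℕ) (hL : Tendsto (fun k => aSeq k * (L k : ℝ)) atTop atTop) (δ : ℝ) :
    QCDRegularisation Nf where
  a := aSeq
  a_pos := aSeq_pos
  tendsto_a := tendsto_aSeq
  β := betaSeq Nf
  L := L
  tendsto_L := hL
  mcrit := thrMass Nf δ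
  Zm := zmSeq Nf
  Zm_pos := zmSeq_pos Nf

/-- Mass scaling of the witness is an identity (`Z_m(k) / (log a_k⁻²)^{γ₀/2β₀} ≡ 1`). -/
theorem thrReg_hasMassScaling (Nf : ℕ) (L : ℕ → ℕ)
    (hL : Tendsto (fun k => aSeq k * (L k : ℝ)) atTop atTop) (δ : ℝ) :
    (thrReg Nf L hL δ).HasMassScaling := by
  refine ⟨1, one_pos, tendsto_const_nhds.congr' (Eventually.of_forall fun k => ?_)⟩
  show (1 : ℝ) = zmSeq Nf k / zmSeq Nf k
  exact (div_self (zmSeq_pos Nf k).ne').symm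

/-- Asymptotic scaling of the witness is an identity (`β_k - afBeta N_f 1 a_k ≡ 0`). -/
theorem thrReg_hasAsymptoticScaling (Nf : ℕ) (L : ℕ → ℕ)
    (hL : Tendsto (fun k => aSeq k * (L k : ℝ)) atTop atTop) (δ : ℝ) :
    ((thrReg Nf L hL δ).scheme 0 0 0).HasAsymptoticScaling := by
  refine ⟨1, one_pos, tendsto_const_nhds.congr' (Eventually.of_forall fun k => ?_)⟩
  show (0 : ℝ) = betaSeq Nf k - afBeta Nf 1 (aSeq k)
  rw [betaSeq, sub_self]

/-! ### §5 The entry sum as a random variable; the light inputs -/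

/-- The colour–spin entry sum `X_{f,v}(U) = Σ_{a,i,b,j} |G_f(U)((0,a,i),(v,b,j))|` of the flavour-`f`
quark propagator from `0` to `v` on the torus of side `2S+1` — the random variable whose
phase-quenched `s`-th moment is `fm`. -/
def propSum (Nf S : ℕ) (t : Fin Nf → ℝ) (f : Fin Nf) (v : Literature.Probability.LatticeModels.Site 4)
    (U : GaugeConfig 4 (2 * S + 1) SU3) : ℝ :=
  ∑ a : Fin 3, ∑ i : Fin 4, ∑ b : Fin 3, ∑ j : Fin 4,
    ‖(diracMatrix U t)⁻¹ (quarkEquiv (f, (Torus.proj (2 * S + 1) 0, a, i)))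
      (quarkEquiv (f, (Torus.proj (2 * S + 1) v, b, j)))‖

/-- The entry sum is non-negative. -/
theorem propSum_nonneg (Nf S : ℕ) (t : Fin Nf → ℝ) (f : Fin Nf)
    (v : Literature.Probability.LatticeModels.Site 4) (U : GaugeConfig 4 (2 * S + 1) SU3) :
    0 ≤ propSum Nf S t f v U :=
  Finset.sum_nonneg fun _ _ => Finset.sum_nonneg fun _ _ => Finset.sum_nonneg fun _ _ =>
    Finset.sum_nonneg fun _ _ => norm_nonneg _

/-- **`TypicalLightChannel Nf`** — the infrared input in its weakest usable probabilistic form. There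
is a physical rate `r` such that, eventually in `k`, at SOME bare mass `x > -1` (degenerate tuple) some
flavour's propagator entry sum is NOT small on a set of gauge fields of phase-quenched probability
bounded below, uniformly in the volume and the distance: for all tori `2S+1 ≥ 2S₀+1` and all `n ≤ S`,
`P₊,β_k,S,x [ Σ_{a,i,b,j}|G_f(0, n e₀)| ≥ c · e^{-r a_k n} ] ≥ π₀` (`c, π₀ > 0` and `S₀` may depend on
`k`). Physically: light hadrons exist on the Wilson bare axis above `-1` at weak coupling AND the light
channel is carried by typical gauge fields.  The STRONGER, probabilistic form of the light input (wave-1 stub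
`stub_lightChannel`); it implies `LightMoment` by Markov from below. -/
def TypicalLightChannel (Nf : ℕ) : Prop :=
  ∃ r : ℝ, ∀ᶠ k in atTop, ∃ x : ℝ, -1 < x ∧ ∃ (f : Fin Nf) (c π₀ : ℝ), 0 < c ∧ 0 < π₀ ∧ ∃ S₀ : ℕ,
    ∀ S : ℕ, S₀ ≤ S → ∀ n : ℕ, n ≤ S →
      π₀ ≤ (qcdLatticeMeasure (2 * S + 1) (betaSeq Nf k) (fun _ : Fin Nf => x)).real
        {U | c * Real.exp (-(r * (aSeq k * n))) ≤
          propSum Nf S (fun _ => x) f (Pi.single 0 (n : ℤ)) U}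

/-- **`LightMoment Nf`** — the light input in ½-MOMENT currency (the weakest form the composition consumes;
registered stub `stub_lightMoment` is this statement unfolded into tree vocabulary): there is a physical
rate `r` such that, eventually in `k`, at SOME bare mass `x > -1` (degenerate tuple) some flavour's
phase-quenched ½-moment obeys `c · e^{-r a_k n} ≤ E_{|w|,β_k,S,x}[(Σ|G_f(0, n e₀)|)^{1/2}]` for all tori
`S ≥ S₀` and all `n ≤ S` (`c > 0`, `S₀` may depend on `k`).  Physically: a lattice correlation length
`≥ e^{k+1}/r` exists on the Wilson bare axis above `-1` at coupling `β_k` (the chiral critical point). -/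
def LightMoment (Nf : ℕ) : Prop :=
  ∃ r : ℝ, ∀ᶠ k in atTop, ∃ x : ℝ, -1 < x ∧ ∃ (f : Fin Nf) (c : ℝ), 0 < c ∧ ∃ S₀ : ℕ,
    ∀ S : ℕ, S₀ ≤ S → ∀ n : ℕ, n ≤ S →
      c * Real.exp (-(r * (aSeq k * n))) ≤ fm Nf (betaSeq Nf k) (fun _ => x) S f (Pi.single 0 (n : ℤ)) (1 / 2)

/-! ### §6 Packaged laws: the registered stub statements and the three inputs of the composition -/

/-- LAW (registered stub `stub_lightMoment`, folded): the light ½-moment input for `N_f ∈ {2,3}`. -/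
def LawLightMoment : Prop :=
  ∀ Nf : ℕ, Nf = 2 ∨ Nf = 3 → LightMoment Nf

/-- The stronger probabilistic light law (wave-1 stub `stub_lightChannel`, folded); implies `LawLightMoment`. -/
def LawLight : Prop :=
  ∀ Nf : ℕ, Nf = 2 ∨ Nf = 3 → TypicalLightChannel Nf

/-- COMPOSITION INPUT 1 (a theorem of `LawLightMoment`): for every large rate `δ`, eventually in `k`, some
bare mass `x > -1` is a BAD floor of the (ii)-certificate — so the threshold is a genuine point of the
branch, `-1 < thrMass`. -/
def LawBadFloor : Prop :=
  ∀ Nf : ℕ, Nf = 2 ∨ Nf = 3 → ∀ᶠ δ in atTop, ∀ᶠ k in atTop, ∃ x : ℝ, -1 < x ∧ ¬ IsGoodFloor Nf δ k x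

/-- LAW = COMPOSITION INPUT 2 (registered stub `stub_lower`): clause (iii) in the renormalised window above
the threshold, on all tori above the volume floor — for every large `δ` and every `M > 0` there are
`s ∈ (0,1)`, `c₀ > 0`, `C₁`, `p` with `c₀ e^{-C₁ a_k n}(n+1)^{-p} ≤ E_{|w|,β_k,S,t}[(Σ|G_f(0,n e₀)|)^s]` for
all large `k`, all window tuples `t ∈ (thrMass, thrMass + a_k M/Z_m]^{N_f}`, all `S ≥ L⁰_k`, `f`, `n ≤ S`
("quarks are not lattice-heavy at the decay threshold": no jump of the physical rate across the threshold,
k-uniform near-free UV corner, volume-independence of the phase-quenched state).  The wave-1 split into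
`NoJump ∧ Transport` through an amplitude-free slow-point predicate moved no content (stub worker, wave 2:
for `R < δ` a certified `R`-slow point is pinned to the shell `a_k‖v‖ ≤ δ/(δ-R)` with a `k`-uniform floor,
physically empty at large `k`; for `R ≥ δ` slowness is uninformative) and is retired. -/
def LawLower : Prop :=
  ∀ Nf : ℕ, Nf = 2 ∨ Nf = 3 →
    ∀ᶠ δ in atTop, ∀ M : ℝ, 0 < M → ∃ s c₀ C₁ p : ℝ, 0 < s ∧ s < 1 ∧ 0 < c₀ ∧ ∀ᶠ k in atTop,
      (floorSet Nf δ k).Nonempty → -1 < thrMass Nf δ k → ∀ t : Fin Nf → ℝ,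
        (∀ f, thrMass Nf δ k < t f) → (∀ f, t f ≤ thrMass Nf δ k + aSeq k * M / zmSeq Nf k) →
          ∀ S : ℕ, volFloor k ≤ S → ∀ (f : Fin Nf) (n : ℕ), n ≤ S →
            c₀ * Real.exp (-(C₁ * (aSeq k * n) + p * Real.log (n + 1))) ≤
              fm Nf (betaSeq Nf k) t S f (Pi.single 0 (n : ℤ)) s

/-- LAW (registered stub `stub_extinct`, folded): DEEP REAL-MODE CROSSERS ARE EXTINCT AT THE SCHEME'S OWN
VOLUME — for `N_f ∈ {2,3}` there is an admissible volume sequence `L ≥ L⁰` (eventually) such that for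
every large `δ`, every `M > 0`, eventually in `k`, for every window tuple `t` the phase-quenched expected
number `Σ_f #{real eigenvalues of D_W(U,0,1) below −t_f}` on the torus of side `2L_k+1` is `≤ 1/4`. -/
def LawExtinct : Prop :=
  ∀ Nf : ℕ, Nf = 2 ∨ Nf = 3 → ∃ L : ℕ → ℕ, Tendsto (fun k => aSeq k * (L k : ℝ)) atTop atTop ∧
    (∀ᶠ k in atTop, volFloor k ≤ L k) ∧ ∀ᶠ δ in atTop, ∀ M : ℝ, 0 < M → ∀ᶠ k in atTop,
      (floorSet Nf δ k).Nonempty → -1 < thrMass Nf δ k → ∀ t : Fin Nf → ℝ,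
        (∀ f, thrMass Nf δ k < t f) → (∀ f, t f ≤ thrMass Nf δ k + aSeq k * M / zmSeq Nf k) →
          (∫ U : GaugeConfig 4 (2 * L k + 1) (Matrix.specialUnitaryGroup (Fin 3) ℂ),
              (∑ f : Fin Nf, (Multiset.countP (fun z : ℂ => z.im = 0 ∧ z.re < -t f)
                (wilsonDirac (fundamentalRep (Fin 3)) U 0 1).charpoly.roots : ℝ)) *
                ∏ f : Fin Nf, ‖fermionDet (wilsonDirac (fundamentalRep (Fin 3)) U (t f) 1)‖
              ∂(wilsonMeasure (d := 4) (L := 2 * L k + 1) (fundamentalRep (Fin 3)) (betaSeq Nf k))) /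
            (∫ U : GaugeConfig 4 (2 * L k + 1) (Matrix.specialUnitaryGroup (Fin 3) ℂ),
              ∏ f : Fin Nf, ‖fermionDet (wilsonDirac (fundamentalRep (Fin 3)) U (t f) 1)‖
              ∂(wilsonMeasure (d := 4) (L := 2 * L k + 1) (fundamentalRep (Fin 3)) (betaSeq Nf k))) ≤ 1 / 4

/-- COMPOSITION INPUT 3 (clause (iv) in the window on some admissible volume sequence above the floor; a
theorem of `LawExtinct` by the landed `PositivityDeficitLeDefects`). -/
def LawSign : Prop :=
  ∀ Nf : ℕ, Nf = 2 ∨ Nf = 3 → ∃ L : ℕ → ℕ, Tendsto (fun k => aSeq k * (L k : ℝ)) atTop atTop ∧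
    (∀ᶠ k in atTop, volFloor k ≤ L k) ∧ ∀ᶠ δ in atTop, ∀ M : ℝ, 0 < M → ∀ᶠ k in atTop,
      (floorSet Nf δ k).Nonempty → -1 < thrMass Nf δ k → ∀ t : Fin Nf → ℝ,
        (∀ f, thrMass Nf δ k < t f) → (∀ f, t f ≤ thrMass Nf δ k + aSeq k * M / zmSeq Nf k) →
          (1 / 2 : ℝ) ≤
            ‖∫ U : GaugeConfig 4 (2 * L k + 1) (Matrix.specialUnitaryGroup (Fin 3) ℂ),
                (diracMatrix U t).det ∂(wilsonMeasure (fundamentalRep (Fin 3)) (betaSeq Nf k))‖ /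
              (∫ U : GaugeConfig 4 (2 * L k + 1) (Matrix.specialUnitaryGroup (Fin 3) ℂ),
                ‖(diracMatrix U t).det‖ ∂(wilsonMeasure (fundamentalRep (Fin 3)) (betaSeq Nf k)))

/-- Registry anchor (vacuous `N_f = 0` slice of the threshold logic): with no flavours every tuple is
certified, so every floor `u ≥ -1` is good and the threshold is `-1`. [folklore] -/
theorem thrMass_nf_zero : ∀ (δ : ℝ) (k : ℕ), thrMass 0 δ k = -1 := by
  intro δ k
  have hgood : ∀ u : ℝ, IsGoodFloor 0 δ k u := fun u t _ _ S _ f => (IsEmpty.false f).elim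
  have hset : floorSet 0 δ k = Set.Ici (-1) := by
    ext u
    exact ⟨fun hu => hu.1, fun hu => ⟨hu, hgood u⟩⟩
  rw [thrMass, hset, csInf_Ici]

end Summit.QuantumFields.QCD.Theorems.MobilityGapSketch

end
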